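import Literature.NumberTheory.Automorphic.UnitaryGroupRestrictedProduct
import HarnessLib

/-!
# Transport of unitary groups of forms: change of basis and reindexing

Registry: pub-hodgecm MODEL-CONSTRUCTION sub-cell, MODEL-DAG node **U2** (vii) — generic glue requested at the
`K_∞`-junction (A2-iii `U21KTypes` ↔ U2-vi `UnitaryGroup.archLocal`): identifying the unitary group of a
hermitian matrix `H` with that of an isometric one `σ(T)ᵀ H T` (Sylvester normal form) and with a reindexed one
`H.submatrix e e` (`Fin 3 ≃ Fin 2 ⊕ Unit`).

For a commutative ring `R` with a ring endomorphism `σ` and the tree's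
`unitaryGroupOfForm σ H = {g ∈ GL_n(R) ∣ σ(g)ᵀ H g = H}`:

* `conj_mem_unitaryGroupOfForm_iff`: `T g T⁻¹ ∈ U(σ, H) ↔ g ∈ U(σ, σ(T)ᵀ H T)` for `T ∈ GL_n(R)`;
  **`unitaryGroupOfFormCongr σ T H : U(σ, σ(T)ᵀ H T) ≃ₜ* U(σ, H)`**, `g ↦ T g T⁻¹` (topological groups);
* `reindex_mem_unitaryGroupOfForm_iff` and **`unitaryGroupOfFormReindex σ e H : U(σ, H.submatrix e e) ≃ₜ* U(σ, H)`**
  along `e : m ≃ n` (`GLn.reindexEquiv e : GL_m(R) ≃ₜ* GL_n(R)`);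
* over `ℂ` (or any star ring with `σ = star`): `mem_unitaryGroupOfForm_star_iff_conjTranspose`
  (`g ∈ U(⋆, H) ↔ gᴴ H g = H`) and `Unitary.toUnits` lands `Matrix.unitaryGroup n R` in `U(⋆, 1)`
  (`toUnits_mem_unitaryGroupOfForm_one`, and conversely `mem_unitaryGroupOfForm_one_iff`).

All elementary and proved. Reference for the objects: Platonov–Rapinchuk 1994, §2.3 (unitary groups of
hermitian forms; equivalent forms give conjugate groups).
-/

noncomputable section

open scoped Matrix MatrixGroups

namespace Literature.NumberTheory.Automorphic

section Conj

variable {R : Type*} [CommRing R] {n : Type*} [Fintype n] [DecidableEq n] (σ : R →+* R)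

/-- The form `σ(T)ᵀ H T` obtained from `H` by the change of basis `T`. [folklore] -/
abbrev formCongr (T : GL n R) (H : Matrix n n R) : Matrix n n R :=
  ((T : Matrix n n R).map σ)ᵀ * H * (T : Matrix n n R)

/-- `σ(T) σ(T⁻¹) = 1` for `T ∈ GL_n(R)`. [folklore] -/
theorem GLn.map_val_mul_map_val_inv (T : GL n R) :
    (T : Matrix n n R).map σ * ((T⁻¹ : GL n R) : Matrix n n R).map σ = 1 := by
  rw [← Matrix.map_mul, ← Units.val_mul, mul_inv_cancel, Units.val_one, Matrix.map_one σ (map_zero σ) (map_one σ)]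

/-- **Change of basis**: if `g` preserves `σ(T)ᵀ H T` then `T g T⁻¹` preserves `H`. [folklore] -/
theorem conj_mem_unitaryGroupOfForm (T : GL n R) (H : Matrix n n R) {g : GL n R}
    (hg : g ∈ unitaryGroupOfForm σ (formCongr σ T H)) : T * g * T⁻¹ ∈ unitaryGroupOfForm σ H := by
  rw [mem_unitaryGroupOfForm_iff] at hg ⊢
  have h1 := GLn.map_val_mul_map_val_inv σ T
  have h2 : (T : Matrix n n R) * ((T⁻¹ : GL n R) : Matrix n n R) = 1 := by
    rw [← Units.val_mul, mul_inv_cancel, Units.val_one]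
  simp only [Units.val_mul, Matrix.map_mul, Matrix.transpose_mul]
  calc (((T⁻¹ : GL n R) : Matrix n n R).map σ)ᵀ * ((((g : GL n R) : Matrix n n R).map σ)ᵀ *
          (((T : GL n R) : Matrix n n R).map σ)ᵀ) * H * ((T : Matrix n n R) * (g : Matrix n n R) *
          ((T⁻¹ : GL n R) : Matrix n n R))
        = (((T⁻¹ : GL n R) : Matrix n n R).map σ)ᵀ * ((((g : GL n R) : Matrix n n R).map σ)ᵀ *
            ((((T : GL n R) : Matrix n n R).map σ)ᵀ * H * (T : Matrix n n R)) * (g : Matrix n n R)) *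
            ((T⁻¹ : GL n R) : Matrix n n R) := by
          simp only [Matrix.mul_assoc]
    _ = (((T⁻¹ : GL n R) : Matrix n n R).map σ)ᵀ * ((((T : GL n R) : Matrix n n R).map σ)ᵀ * H *
            (T : Matrix n n R)) * ((T⁻¹ : GL n R) : Matrix n n R) := by
          rw [show (((g : GL n R) : Matrix n n R).map σ)ᵀ * ((((T : GL n R) : Matrix n n R).map σ)ᵀ * H *
            (T : Matrix n n R)) * (g : Matrix n n R) = _ from hg]
    _ = ((((T⁻¹ : GL n R) : Matrix n n R).map σ)ᵀ * (((T : GL n R) : Matrix n n R).map σ)ᵀ) * H *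
            ((T : Matrix n n R) * ((T⁻¹ : GL n R) : Matrix n n R)) := by
          simp only [Matrix.mul_assoc]
    _ = H := by
          rw [← Matrix.transpose_mul, h1, h2, Matrix.transpose_one, Matrix.one_mul, Matrix.mul_one]

/-- `σ(T⁻¹)ᵀ (σ(T)ᵀ H T) T⁻¹ = H`: changing basis back. [folklore] -/
theorem formCongr_inv_formCongr (T : GL n R) (H : Matrix n n R) : formCongr σ T⁻¹ (formCongr σ T H) = H := by
  have h1 := GLn.map_val_mul_map_val_inv σ T
  have h2 : (T : Matrix n n R) * ((T⁻¹ : GL n R) : Matrix n n R) = 1 := by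
    rw [← Units.val_mul, mul_inv_cancel, Units.val_one]
  simp only [formCongr]
  calc (((T⁻¹ : GL n R) : Matrix n n R).map σ)ᵀ * ((((T : GL n R) : Matrix n n R).map σ)ᵀ * H *
          (T : Matrix n n R)) * ((T⁻¹ : GL n R) : Matrix n n R)
        = ((((T⁻¹ : GL n R) : Matrix n n R).map σ)ᵀ * (((T : GL n R) : Matrix n n R).map σ)ᵀ) * H *
            ((T : Matrix n n R) * ((T⁻¹ : GL n R) : Matrix n n R)) := by
          simp only [Matrix.mul_assoc]
    _ = H := by
          rw [← Matrix.transpose_mul, h1, h2, Matrix.transpose_one, Matrix.one_mul, Matrix.mul_one]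

/-- **`T g T⁻¹ ∈ U(σ, H) ↔ g ∈ U(σ, σ(T)ᵀ H T)`.** [folklore] -/
theorem conj_mem_unitaryGroupOfForm_iff (T : GL n R) (H : Matrix n n R) (g : GL n R) :
    T * g * T⁻¹ ∈ unitaryGroupOfForm σ H ↔ g ∈ unitaryGroupOfForm σ (formCongr σ T H) := by
  refine ⟨fun h => ?_, conj_mem_unitaryGroupOfForm σ T H⟩
  have h' : T * g * T⁻¹ ∈ unitaryGroupOfForm σ (formCongr σ T⁻¹ (formCongr σ T H)) := by
    rwa [formCongr_inv_formCongr]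
  have := conj_mem_unitaryGroupOfForm σ T⁻¹ (formCongr σ T H) h'
  simpa [mul_assoc] using this

end Conj

section ConjTop

variable {R : Type*} [CommRing R] [TopologicalSpace R] [IsTopologicalRing R] {n : Type*} [Fintype n]
  [DecidableEq n] (σ : R →+* R)

/-- Conjugation by `T` as an isomorphism of topological groups (Mathlib `MulAut.conj` + continuity). [folklore] -/
def GLn.conjEquiv (T : GL n R) : GL n R ≃ₜ* GL n R :=
  { MulAut.conj T with
    continuous_toFun := (continuous_const.mul continuous_id).mul continuous_const
    continuous_invFun := (continuous_const.mul continuous_id).mul continuous_const }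

/-- `GLn.conjEquiv T g = T g T⁻¹`. [folklore] -/
@[simp] theorem GLn.conjEquiv_apply (T g : GL n R) : GLn.conjEquiv T g = T * g * T⁻¹ := rfl

/-- **`U(σ, σ(T)ᵀ H T) ≃ₜ* U(σ, H)`, `g ↦ T g T⁻¹`**: isometric forms have conjugate unitary groups (e.g. a
hermitian `H` of signature `(p,q)` and its Sylvester normal form `Tᴴ H T = diag(1_p, −1_q)`).
Platonov–Rapinchuk 1994, §2.3. [cite: PlatonovRapinchuk1994, §2.3] -/
def unitaryGroupOfFormCongr (T : GL n R) (H : Matrix n n R) :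
    unitaryGroupOfForm σ (formCongr σ T H) ≃ₜ* unitaryGroupOfForm σ H :=
  ContinuousMulEquiv.restrictSubgroup (GLn.conjEquiv T) _ _ fun g => (conj_mem_unitaryGroupOfForm_iff σ T H g).symm

/-- `unitaryGroupOfFormCongr` on underlying elements: `T g T⁻¹`. [folklore] -/
@[simp] theorem coe_unitaryGroupOfFormCongr_apply (T : GL n R) (H : Matrix n n R)
    (g : unitaryGroupOfForm σ (formCongr σ T H)) :
    ((unitaryGroupOfFormCongr σ T H g : unitaryGroupOfForm σ H) : GL n R) = T * g * T⁻¹ := rfl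

/-- `unitaryGroupOfFormCongr.symm` on underlying elements: `T⁻¹ g T`. [folklore] -/
@[simp] theorem coe_unitaryGroupOfFormCongr_symm_apply (T : GL n R) (H : Matrix n n R) (g : unitaryGroupOfForm σ H) :
    (((unitaryGroupOfFormCongr σ T H).symm g : unitaryGroupOfForm σ (formCongr σ T H)) : GL n R) = T⁻¹ * g * T :=
  rfl

/-- **Hypothesis form**: given an isometry `σ(T)ᵀ H T = H'` (e.g. a Sylvester datum `Tᴴ H T = diag(1,1,−1)`),
`U(σ, H') ≃ₜ* U(σ, H)`, `g ↦ T g T⁻¹`. [cite: PlatonovRapinchuk1994, §2.3] -/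
def unitaryGroupOfFormCongrOfEq (T : GL n R) (H H' : Matrix n n R) (h : formCongr σ T H = H') :
    unitaryGroupOfForm σ H' ≃ₜ* unitaryGroupOfForm σ H :=
  ContinuousMulEquiv.restrictSubgroup (GLn.conjEquiv T) _ _ fun g => by
    rw [← h]; exact (conj_mem_unitaryGroupOfForm_iff σ T H g).symm

/-- `unitaryGroupOfFormCongrOfEq` on underlying elements: `T g T⁻¹`. [folklore] -/
@[simp] theorem coe_unitaryGroupOfFormCongrOfEq_apply (T : GL n R) (H H' : Matrix n n R)
    (h : formCongr σ T H = H') (g : unitaryGroupOfForm σ H') :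
    ((unitaryGroupOfFormCongrOfEq σ T H H' h g : unitaryGroupOfForm σ H) : GL n R) = T * g * T⁻¹ := rfl

/-- `unitaryGroupOfFormCongrOfEq.symm` on underlying elements: `T⁻¹ g T`. [folklore] -/
@[simp] theorem coe_unitaryGroupOfFormCongrOfEq_symm_apply (T : GL n R) (H H' : Matrix n n R)
    (h : formCongr σ T H = H') (g : unitaryGroupOfForm σ H) :
    (((unitaryGroupOfFormCongrOfEq σ T H H' h).symm g : unitaryGroupOfForm σ H') : GL n R) = T⁻¹ * g * T :=
  rfl

end ConjTop

section Reindex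

variable {R : Type*} [CommRing R] [TopologicalSpace R] {m n : Type*} [Fintype m] [DecidableEq m] [Fintype n]
  [DecidableEq n] (σ : R →+* R)

/-- Reindexing square matrices along `e : m ≃ n` as an isomorphism of topological monoids (Mathlib
`Matrix.reindexRingEquiv` + continuity of `submatrix`). [folklore] -/
def Matrix.reindexContinuousMulEquiv (e : m ≃ n) : Matrix m m R ≃ₜ* Matrix n n R :=
  { (Matrix.reindexRingEquiv R e).toMulEquiv with
    continuous_toFun := continuous_id.matrix_submatrix _ _
    continuous_invFun := continuous_id.matrix_submatrix _ _ }

omit [DecidableEq m] [DecidableEq n] in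
/-- `Matrix.reindexContinuousMulEquiv e M = reindex e e M`. [folklore] -/
@[simp] theorem Matrix.reindexContinuousMulEquiv_apply (e : m ≃ n) (M : Matrix m m R) :
    Matrix.reindexContinuousMulEquiv (R := R) e M = Matrix.reindex e e M := rfl

/-- **`GL_m(R) ≃ₜ* GL_n(R)` along `e : m ≃ n`** (reindexing rows and columns). [folklore] -/
def GLn.reindexEquiv (e : m ≃ n) : GL m R ≃ₜ* GL n R :=
  Units.mapContinuousMulEquiv (Matrix.reindexContinuousMulEquiv (R := R) e)

/-- Underlying matrix of `GLn.reindexEquiv e g`: `reindex e e g`. [folklore] -/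
@[simp] theorem GLn.coe_reindexEquiv_apply (e : m ≃ n) (g : GL m R) :
    ((GLn.reindexEquiv (R := R) e g : GL n R) : Matrix n n R) = Matrix.reindex e e (g : Matrix m m R) := rfl

omit [CommRing R] [TopologicalSpace R] [Fintype m] [DecidableEq m] [Fintype n] [DecidableEq n] in
/-- `reindex e e (H.submatrix e e) = H`. [folklore] -/
theorem Matrix.reindex_submatrix_self (e : m ≃ n) (H : Matrix n n R) :
    Matrix.reindex e e (H.submatrix e e) = H := by
  rw [Matrix.reindex_apply, Matrix.submatrix_submatrix, Equiv.self_comp_symm, Matrix.submatrix_id_id]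

omit [TopologicalSpace R] in
/-- **`reindex e e g ∈ U(σ, H) ↔ g ∈ U(σ, H.submatrix e e)`.** [folklore] -/
theorem reindex_mem_unitaryGroupOfForm_iff (e : m ≃ n) (H : Matrix n n R) (g : GL m R) :
    g ∈ unitaryGroupOfForm σ (H.submatrix e e) ↔
      (Units.mapEquiv (Matrix.reindexRingEquiv R e).toMulEquiv g : GL n R) ∈ unitaryGroupOfForm σ H := by
  set φ := Matrix.reindexRingEquiv R e
  have hT : ∀ A : Matrix m m R, φ Aᵀ = (φ A)ᵀ := fun _ => rfl
  have hσ : ∀ A : Matrix m m R, φ (A.map σ) = (φ A).map σ := fun _ => rfl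
  have hH : φ (H.submatrix e e) = H := Matrix.reindex_submatrix_self e H
  have hval : ((Units.mapEquiv φ.toMulEquiv g : GL n R) : Matrix n n R) = φ (g : Matrix m m R) := rfl
  rw [mem_unitaryGroupOfForm_iff, mem_unitaryGroupOfForm_iff, hval]
  constructor
  · intro h
    have key := congrArg φ h
    rwa [map_mul, map_mul, hT, hσ, hH] at key
  · intro h
    apply φ.injective
    rw [map_mul, map_mul, hT, hσ, hH]
    exact h

/-- **`U(σ, H.submatrix e e) ≃ₜ* U(σ, H)`** along a reindexing `e : m ≃ n` (e.g. `Fin 3 ≃ Fin 2 ⊕ Unit`).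
[folklore] -/
def unitaryGroupOfFormReindex (e : m ≃ n) (H : Matrix n n R) :
    unitaryGroupOfForm σ (H.submatrix e e) ≃ₜ* unitaryGroupOfForm σ H :=
  ContinuousMulEquiv.restrictSubgroup (GLn.reindexEquiv (R := R) e) _ _
    fun g => reindex_mem_unitaryGroupOfForm_iff σ e H g

/-- `unitaryGroupOfFormReindex` on underlying matrices: `reindex e e g`. [folklore] -/
@[simp] theorem coe_unitaryGroupOfFormReindex_apply (e : m ≃ n) (H : Matrix n n R)
    (g : unitaryGroupOfForm σ (H.submatrix e e)) :
    (((unitaryGroupOfFormReindex σ e H g : unitaryGroupOfForm σ H) : GL n R) : Matrix n n R) =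
      Matrix.reindex e e ((g : GL m R) : Matrix m m R) :=
  rfl

end Reindex

section Star

variable {R : Type*} [CommRing R] [StarRing R] {n : Type*} [Fintype n] [DecidableEq n]

/-- Over a star ring with `σ = star` (e.g. `ℂ` with complex conjugation): `g ∈ U(⋆, H) ↔ gᴴ H g = H`. [folklore] -/
theorem mem_unitaryGroupOfForm_star_iff_conjTranspose (H : Matrix n n R) (g : GL n R) :
    g ∈ unitaryGroupOfForm (starRingEnd R) H ↔ (g : Matrix n n R)ᴴ * H * (g : Matrix n n R) = H := by
  rw [mem_unitaryGroupOfForm_iff, Matrix.conjTranspose, Matrix.transpose_map]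
  rfl

/-- Over a star ring, `formCongr ⋆ T H = Tᴴ H T` (the shape of a Sylvester datum `Tᴴ H T = diag(…)`). [folklore] -/
theorem formCongr_star (T : GL n R) (H : Matrix n n R) :
    formCongr (starRingEnd R) T H = (T : Matrix n n R)ᴴ * H * (T : Matrix n n R) := by
  rw [formCongr, Matrix.conjTranspose, Matrix.transpose_map]
  rfl

/-- Mathlib's `Matrix.unitaryGroup n R` maps into `U(⋆, 1)` under `Unitary.toUnits`. [folklore] -/
theorem toUnits_mem_unitaryGroupOfForm_one (u : Matrix.unitaryGroup n R) :
    (Unitary.toUnits u : GL n R) ∈ unitaryGroupOfForm (starRingEnd R) (1 : Matrix n n R) := by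
  rw [mem_unitaryGroupOfForm_star_iff_conjTranspose, Matrix.mul_one]
  exact Matrix.UnitaryGroup.star_mul_self u

/-- Conversely `g ∈ U(⋆, 1)` iff `gᴴ g = 1`, i.e. iff `(g : Matrix) ∈ Matrix.unitaryGroup n R`. [folklore] -/
theorem mem_unitaryGroupOfForm_one_iff (g : GL n R) :
    g ∈ unitaryGroupOfForm (starRingEnd R) (1 : Matrix n n R) ↔ (g : Matrix n n R) ∈ Matrix.unitaryGroup n R := by
  rw [mem_unitaryGroupOfForm_star_iff_conjTranspose, Matrix.mul_one, Matrix.mem_unitaryGroup_iff']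
  rfl

/-- A `J`-unitary matrix (`gᴴ J g = J`, e.g. the tree's `U21.blockDiag k` with `U21.J`) that is invertible gives
an element of `U(⋆, J)`. [folklore] -/
theorem mem_unitaryGroupOfForm_star_of_conjTranspose (J : Matrix n n R) (g : GL n R)
    (h : (g : Matrix n n R)ᴴ * J * (g : Matrix n n R) = J) : g ∈ unitaryGroupOfForm (starRingEnd R) J :=
  (mem_unitaryGroupOfForm_star_iff_conjTranspose J g).2 h

end Star

end Literature.NumberTheory.Automorphic

end
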